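import Mathlib
import HarnessLib
import Literature.NumberTheory.DiophantineGeometry.RothPrelim
import Literature.NumberTheory.DiophantineGeometry.RothTaylor

/-!
# Roth's theorem after Schmidt (LNM 785, Ch. V) — heights of sums, products and Wronskians

Source: W. M. Schmidt, *Diophantine Approximation*, LNM 785 (1980), Ch. V §10, proof of Lemma 10B
(book pp. 131–132) [Schmidt1980]: the estimate (10.10) of the height of the generalized
Wronskian `W = det (P_{μ_i, j-1})` and the remark that `|W| = |V*| · |U*|` forces
`|U*|, |V*| ≤ |W|`.

The elementary height calculus for `Roth.height` (`RothPrelim`) used there: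
`|Σ Q_s| ≤ Σ |Q_s|` (`Roth.height_sum_le`), `|Q₁Q₂| ≤ #supp(Q₂) |Q₁| |Q₂|`
(`Roth.height_mul_le`), hence `|Π_i Q_i| ≤ Π_i (#supp Q_i · |Q_i|)` (`Roth.height_prod_le`) and
`|det M| ≤ k! (T H)^k` for a `k × k` matrix of integer polynomials with `≤ T` terms and heights
`≤ H` (`Roth.height_det_le`); supports and heights of the derivatives `P_i`
(`Roth.card_support_hasseD_le`); and for a product `W = V U` of a polynomial `V` free of the
variable `X_{t₀}` with a polynomial `U` in `X_{t₀}` alone: the coefficients of `W` are the products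
of those of `V` and `U` (`Roth.coeff_mul_of_disjoint`), so `|W| = |V| |U|`
(`Roth.height_mul_of_disjoint`), and the normalised derivatives split,
`W_{i + ν e_{t₀}} = V_i U_{ν e_{t₀}}` (`Roth.hasseD_mul_of_disjoint`). These feed the bottom half of
the inductive step of Roth's Lemma 10A (`RothLemma…`).

## References

* [Schmidt1980] W. M. Schmidt, *Diophantine Approximation*, LNM 785, Springer 1980, Ch. V,
  proof of Lemma 10B, (10.10), pp. 131–132.
-/

noncomputable section

open MvPolynomial Finset

namespace Literature.NumberTheory.DiophantineGeometry

namespace Roth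

variable {σ : Type*}

/-! ### Height calculus -/

/-- `|P + Q| ≤ |P| + |Q|`. [folklore] -/
theorem height_add_le (P Q : MvPolynomial σ ℤ) : height (P + Q) ≤ height P + height Q := by
  rw [height_le_iff]
  intro j
  rw [coeff_add]
  exact (Int.natAbs_add_le _ _).trans
    (Nat.add_le_add (natAbs_coeff_le_height P j) (natAbs_coeff_le_height Q j))

/-- `|-P| = |P|`. [folklore] -/
@[simp] theorem height_neg (P : MvPolynomial σ ℤ) : height (-P) = height P := by
  unfold height
  rw [support_neg]
  apply Finset.sup_congr rfl
  intro j _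
  rw [coeff_neg, Int.natAbs_neg]

/-- `|Σ_s Q_s| ≤ Σ_s |Q_s|`. [folklore] -/
theorem height_sum_le {ι : Type*} (s : Finset ι) (Q : ι → MvPolynomial σ ℤ) :
    height (∑ x ∈ s, Q x) ≤ ∑ x ∈ s, height (Q x) := by
  classical
  induction s using Finset.induction_on with
  | empty => simp
  | insert a s ha ih =>
    rw [Finset.sum_insert ha, Finset.sum_insert ha]
    exact (height_add_le _ _).trans (Nat.add_le_add_left ih _)

/-- `|P Q| ≤ #supp(Q) · |P| · |Q|`: every coefficient of `PQ` is a sum of at most `#supp Q`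
products of coefficients. [cite: Schmidt1980, Ch. V proof of Lemma 10B (10.10)] -/
theorem height_mul_le [DecidableEq σ] (P Q : MvPolynomial σ ℤ) :
    height (P * Q) ≤ Q.support.card * height P * height Q := by
  classical
  rw [height_le_iff]
  intro j
  rw [coeff_mul]
  -- drop the pairs whose second component is not in the support of `Q`
  have h1 : ∑ x ∈ Finset.HasAntidiagonal.antidiagonal j, coeff x.1 P * coeff x.2 Q =
      ∑ x ∈ (Finset.HasAntidiagonal.antidiagonal j).filter (fun x => x.2 ∈ Q.support),
        coeff x.1 P * coeff x.2 Q := by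
    rw [Finset.sum_filter]
    apply Finset.sum_congr rfl
    intro x _
    split_ifs with h
    · rfl
    · rw [notMem_support_iff.mp h, mul_zero]
  rw [h1]
  refine (Int.natAbs_sum_le _ _).trans ?_
  have h2 : ∀ x ∈ (Finset.HasAntidiagonal.antidiagonal j).filter (fun x => x.2 ∈ Q.support),
      (coeff x.1 P * coeff x.2 Q).natAbs ≤ height P * height Q := by
    intro x _
    rw [Int.natAbs_mul]
    exact Nat.mul_le_mul (natAbs_coeff_le_height P _) (natAbs_coeff_le_height Q _)
  refine (Finset.sum_le_sum h2).trans ?_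
  rw [Finset.sum_const, smul_eq_mul, mul_assoc]
  apply Nat.mul_le_mul_right
  -- the filtered antidiagonal injects into `supp Q` via the second projection
  apply Finset.card_le_card_of_injOn (fun x => x.2)
  · intro x hx
    rw [Finset.mem_coe, Finset.mem_filter] at hx
    exact hx.2
  · rintro ⟨x1, x2⟩ hx ⟨y1, y2⟩ hy hxy
    simp only [Finset.mem_coe, Finset.mem_filter, Finset.HasAntidiagonal.mem_antidiagonal] at hx hy hxy
    subst hxy
    have : x1 = y1 := by
      have := hx.1.trans hy.1.symm
      exact add_right_cancel this
    rw [this]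

/-- `|Π_{i∈s} Q_i| ≤ Π_{i∈s} (#supp Q_i · |Q_i|)` (peel off one factor at a time).
[cite: Schmidt1980, Ch. V proof of Lemma 10B (10.10)] -/
theorem height_prod_le [DecidableEq σ] {ι : Type*} (s : Finset ι) (Q : ι → MvPolynomial σ ℤ) :
    height (∏ x ∈ s, Q x) ≤ ∏ x ∈ s, ((Q x).support.card * height (Q x)) := by
  classical
  induction s using Finset.induction_on with
  | empty =>
    simp only [Finset.prod_empty]
    rw [height_le_iff]
    intro j
    rw [coeff_one]
    split_ifs <;> simp
  | insert a s ha ih =>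
    rw [Finset.prod_insert ha, Finset.prod_insert ha, mul_comm (Q a)]
    calc height ((∏ x ∈ s, Q x) * Q a)
        ≤ (Q a).support.card * height (∏ x ∈ s, Q x) * height (Q a) := height_mul_le _ _
      _ ≤ (Q a).support.card * (∏ x ∈ s, ((Q x).support.card * height (Q x))) * height (Q a) :=
          Nat.mul_le_mul_right _ (Nat.mul_le_mul_left _ ih)
      _ = (Q a).support.card * height (Q a) * ∏ x ∈ s, ((Q x).support.card * height (Q x)) := by
          ring

/-- **Height of a determinant**: if every entry of a `k × k` matrix of integer polynomials has at
most `T` terms and height `≤ H`, then `|det M| ≤ k! (T H)^k` (the count behind (10.10): `k!`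
summands, each a product of `k` entries). [cite: Schmidt1980, Ch. V proof of Lemma 10B (10.10)] -/
theorem height_det_le [DecidableEq σ] {k : ℕ} (M : Matrix (Fin k) (Fin k) (MvPolynomial σ ℤ))
    (T H : ℕ) (hT : ∀ i j, (M i j).support.card ≤ T) (hH : ∀ i j, height (M i j) ≤ H) :
    height M.det ≤ k.factorial * (T * H) ^ k := by
  classical
  rw [Matrix.det_apply]
  refine (height_sum_le _ _).trans ?_
  have h1 : ∀ τ : Equiv.Perm (Fin k), height (Equiv.Perm.sign τ • ∏ i, M (τ i) i) ≤ (T * H) ^ k := by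
    intro τ
    have hs : height (Equiv.Perm.sign τ • ∏ i, M (τ i) i) = height (∏ i, M (τ i) i) := by
      rcases Int.units_eq_one_or (Equiv.Perm.sign τ) with h | h
      · rw [h, one_smul]
      · rw [h, Units.neg_smul, one_smul, height_neg]
    rw [hs]
    refine (height_prod_le _ _).trans ?_
    calc ∏ i, ((M (τ i) i).support.card * height (M (τ i) i)) ≤ ∏ _i : Fin k, (T * H) :=
          Finset.prod_le_prod' fun i _ => Nat.mul_le_mul (hT _ _) (hH _ _)
      _ = (T * H) ^ k := by simp
  refine (Finset.sum_le_sum fun τ _ => h1 τ).trans ?_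
  simp [Fintype.card_perm]

/-! ### Supports and heights of the derivatives `P_i` -/

/-- `#supp(P_i) ≤ #supp(P)` (`j ↦ j + i` maps the support of `P_i` into that of `P`).
[folklore] -/
theorem card_support_hasseD_le {R : Type*} [CommSemiring R] (i : σ →₀ ℕ) (P : MvPolynomial σ R) :
    (hasseD i P).support.card ≤ P.support.card := by
  classical
  apply Finset.card_le_card_of_injOn (fun j => j + i)
  · intro j hj
    exact add_mem_support_of_mem_support_hasseD hj
  · intro j₁ _ j₂ _ h
    exact add_right_cancel h

/-- A polynomial of degree `≤ r_h` in `X_h` has at most `∏ₕ (r_h + 1)` monomials.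
[cite: Schmidt1980, Ch. V §8 (p. 126)] -/
theorem card_support_le_prod_succ {R : Type*} [CommSemiring R] [Fintype σ] (P : MvPolynomial σ R)
    (r : σ → ℕ) (hr : ∀ h, P.degreeOf h ≤ r h) : P.support.card ≤ ∏ h, (r h + 1) := by
  classical
  calc P.support.card ≤ (Fintype.piFinset fun h => Finset.range (r h + 1)).card := by
        refine Finset.card_le_card_of_injOn (fun j => ⇑j) ?_ ?_
        · intro j hj
          simp only [Finset.mem_coe, Fintype.mem_piFinset, Finset.mem_range, Nat.lt_succ_iff]
          exact fun h => (monomial_le_degreeOf h hj).trans (hr h)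
        · intro j₁ _ j₂ _ h
          exact DFunLike.coe_injective h
    _ = ∏ h, (r h + 1) := by
        rw [Fintype.card_piFinset]; simp

/-- `∏ₕ (r_h + 1) ≤ 2^{Σ r_h}`. [cite: Schmidt1980, Ch. V §8 (p. 126)] -/
theorem prod_succ_le_two_pow {ι : Type*} (s : Finset ι) (r : ι → ℕ) :
    ∏ h ∈ s, (r h + 1) ≤ 2 ^ (∑ h ∈ s, r h) := by
  rw [← Finset.prod_pow_eq_pow_sum]
  exact Finset.prod_le_prod' fun h _ => Nat.lt_two_pow_self

/-! ### Products in disjoint sets of variables -/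

section Disjoint

variable {R : Type*} [CommRing R] [DecidableEq σ]

/-- The part of a multi-index away from `t₀` and its `t₀`-component recombine. [folklore] -/
theorem erase_add_single (t₀ : σ) (j : σ →₀ ℕ) :
    Finsupp.erase t₀ j + Finsupp.single t₀ (j t₀) = j := by
  ext h
  rcases eq_or_ne h t₀ with rfl | hh
  · simp
  · simp only [Finsupp.coe_add, Pi.add_apply, Finsupp.erase_ne hh, Finsupp.single_apply,
      if_neg (Ne.symm hh), add_zero]

/-- **Coefficients of a product in disjoint variables**: if `V` is free of `X_{t₀}` and `U`
involves only `X_{t₀}`, the coefficient of `X^j` in `VU` is `V_{j'} U_{j_{t₀}}` where `j'` is `j`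
with the `t₀`-component removed. [cite: Schmidt1980, Ch. V proof of Lemma 10B ("clearly there
is a factorization W = V* U*")] -/
theorem coeff_mul_of_disjoint {V U : MvPolynomial σ R} {t₀ : σ} (hV : V.degreeOf t₀ = 0)
    (hU : ∀ h, h ≠ t₀ → U.degreeOf h = 0) (j : σ →₀ ℕ) :
    coeff j (V * U) = coeff (Finsupp.erase t₀ j) V * coeff (Finsupp.single t₀ (j t₀)) U := by
  classical
  rw [coeff_mul, Finset.sum_eq_single (Finsupp.erase t₀ j, Finsupp.single t₀ (j t₀))]
  · rintro ⟨x1, x2⟩ hx hne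
    rw [Finset.HasAntidiagonal.mem_antidiagonal] at hx
    simp only at hx ⊢
    by_cases h1 : x1 t₀ ≠ 0
    · -- `V` has no monomial involving `t₀`
      have : coeff x1 V = 0 := by
        rw [← notMem_support_iff]
        intro hmem
        have := monomial_le_degreeOf t₀ hmem
        rw [hV] at this
        omega
      rw [this, zero_mul]
    · push Not at h1
      by_cases h2 : ∃ h, h ≠ t₀ ∧ x2 h ≠ 0
      · obtain ⟨h, hh, hx2⟩ := h2
        have : coeff x2 U = 0 := by
          rw [← notMem_support_iff]
          intro hmem
          have := monomial_le_degreeOf h hmem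
          rw [hU h hh] at this
          omega
        rw [this, mul_zero]
      · push Not at h2
        exfalso
        apply hne
        have e1 : x1 = Finsupp.erase t₀ j := by
          ext h
          rw [Finsupp.erase_apply]
          split_ifs with hh
          · rw [hh, h1]
          · have := DFunLike.congr_fun hx h
            simp only [Finsupp.coe_add, Pi.add_apply] at this
            rw [h2 h hh] at this
            omega
        have e2 : x2 = Finsupp.single t₀ (j t₀) := by
          ext h
          rw [Finsupp.single_apply]
          split_ifs with hh
          · subst hh
            have := DFunLike.congr_fun hx t₀
            simp only [Finsupp.coe_add, Pi.add_apply] at this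
            omega
          · exact h2 h (Ne.symm hh)
        rw [e1, e2]
  · intro hnot
    exfalso
    exact hnot (Finset.HasAntidiagonal.mem_antidiagonal.mpr (erase_add_single t₀ j))

/-- **`|VU| = |V| · |U|` for integer polynomials in disjoint variables** (so that `|U*|, |V*| ≤ |W|`
in Lemma 10B). [cite: Schmidt1980, Ch. V proof of Lemma 10B ("This yields the estimates")] -/
theorem height_mul_of_disjoint {V U : MvPolynomial σ ℤ} {t₀ : σ} (hV : V.degreeOf t₀ = 0)
    (hU : ∀ h, h ≠ t₀ → U.degreeOf h = 0) : height (V * U) = height V * height U := by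
  classical
  apply le_antisymm
  · rw [height_le_iff]
    intro j
    rw [coeff_mul_of_disjoint hV hU, Int.natAbs_mul]
    exact Nat.mul_le_mul (natAbs_coeff_le_height _ _) (natAbs_coeff_le_height _ _)
  · -- pick coefficients of maximal absolute value
    by_cases hV0 : V = 0
    · simp [hV0]
    by_cases hU0 : U = 0
    · simp [hU0]
    obtain ⟨j1, hj1, hj1max⟩ := Finset.exists_max_image V.support (fun j => (coeff j V).natAbs)
      (support_nonempty.mpr hV0)
    obtain ⟨j2, hj2, hj2max⟩ := Finset.exists_max_image U.support (fun j => (coeff j U).natAbs)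
      (support_nonempty.mpr hU0)
    have hV1 : height V = (coeff j1 V).natAbs :=
      le_antisymm (Finset.sup_le hj1max) (natAbs_coeff_le_height V j1)
    have hU1 : height U = (coeff j2 U).natAbs :=
      le_antisymm (Finset.sup_le hj2max) (natAbs_coeff_le_height U j2)
    -- `j1` is free of `t₀`, `j2` is a multiple of `e_{t₀}`
    have hj1t : j1 t₀ = 0 := by
      have := monomial_le_degreeOf t₀ hj1; rw [hV] at this; omega
    have hj2t : j2 = Finsupp.single t₀ (j2 t₀) := by
      ext h
      rw [Finsupp.single_apply]
      split_ifs with hh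
      · rw [hh]
      · have := monomial_le_degreeOf h hj2; rw [hU h (Ne.symm hh)] at this; omega
    set j := j1 + Finsupp.single t₀ (j2 t₀) with hj
    have hcoeff : coeff j (V * U) = coeff j1 V * coeff j2 U := by
      rw [coeff_mul_of_disjoint hV hU]
      congr 2
      · ext h
        rcases eq_or_ne h t₀ with rfl | hh
        · simp [hj, hj1t]
        · simp only [hj, Finsupp.erase_ne hh, Finsupp.coe_add, Pi.add_apply, Finsupp.single_apply,
            if_neg (Ne.symm hh), add_zero]
      · rw [hj2t]
        simp [hj, hj1t]
    rw [hV1, hU1, ← Int.natAbs_mul, ← hcoeff]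
    exact natAbs_coeff_le_height _ _

omit [DecidableEq σ] in
/-- If `V` does not involve `X_{t₀}` then `V_i = 0` unless `i_{t₀} = 0`. [folklore] -/
theorem hasseD_eq_zero_of_degreeOf_eq_zero' [Fintype σ] {V : MvPolynomial σ R} {t₀ : σ}
    (hV : V.degreeOf t₀ = 0) {i : σ →₀ ℕ} (hi : i t₀ ≠ 0) : hasseD i V = 0 :=
  hasseD_eq_zero_of_degreeOf_lt (h := t₀) (by rw [hV]; omega)

/-- If `U` involves only `X_{t₀}` then `U_i = 0` unless `i` is a multiple of `e_{t₀}`.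
[folklore] -/
theorem hasseD_eq_zero_of_forall_degreeOf_eq_zero' [Fintype σ] {U : MvPolynomial σ R} {t₀ : σ}
    (hU : ∀ h, h ≠ t₀ → U.degreeOf h = 0) {i : σ →₀ ℕ} (hi : i ≠ Finsupp.single t₀ (i t₀)) :
    hasseD i U = 0 := by
  have : ∃ h, h ≠ t₀ ∧ i h ≠ 0 := by
    by_contra hcon
    push Not at hcon
    apply hi
    ext h
    rw [Finsupp.single_apply]
    split_ifs with h1
    · rw [h1]
    · exact hcon h (Ne.symm h1)
  obtain ⟨h, hh, hih⟩ := this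
  exact hasseD_eq_zero_of_degreeOf_lt (h := h) (by rw [hU h hh]; omega)

/-- **Derivatives of a product in disjoint variables** (polynomial identity): if `V` is free of
`X_{t₀}`, `U` involves only `X_{t₀}` and `i_{t₀} = 0`, then `(VU)_{i + ν e_{t₀}} = V_i · U_{ν e_{t₀}}`
(the Leibniz sum (6.1) has a single non-zero term). [cite: Schmidt1980, Ch. V proof of Thm 10A
("W = V U", p. 131)] -/
theorem hasseD_mul_of_disjoint [Fintype σ] {V U : MvPolynomial σ R} {t₀ : σ}
    (hV : V.degreeOf t₀ = 0) (hU : ∀ h, h ≠ t₀ → U.degreeOf h = 0) {i : σ →₀ ℕ} (hi : i t₀ = 0)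
    (ν : ℕ) :
    hasseD (i + Finsupp.single t₀ ν) (V * U) = hasseD i V * hasseD (Finsupp.single t₀ ν) U := by
  classical
  rw [hasseD_mul, Finset.sum_eq_single (i, Finsupp.single t₀ ν)]
  · rintro ⟨x1, x2⟩ hx hne
    rw [Finset.HasAntidiagonal.mem_antidiagonal] at hx
    simp only at hx ⊢
    by_cases h1 : x1 t₀ ≠ 0
    · rw [hasseD_eq_zero_of_degreeOf_eq_zero' hV h1, zero_mul]
    · push Not at h1
      by_cases h2 : x2 = Finsupp.single t₀ (x2 t₀)
      · exfalso
        apply hne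
        have hx2 : x2 t₀ = ν := by
          have := DFunLike.congr_fun hx t₀
          simp only [Finsupp.coe_add, Pi.add_apply, Finsupp.single_eq_same, h1, hi] at this
          omega
        have hx1 : x1 = i := by
          ext h
          have := DFunLike.congr_fun hx h
          simp only [Finsupp.coe_add, Pi.add_apply, Finsupp.single_apply] at this
          by_cases hh : t₀ = h
          · subst hh; rw [h1, hi]
          · rw [if_neg hh] at this
            have hx2h : x2 h = 0 := by rw [h2, Finsupp.single_apply, if_neg hh]
            omega
        rw [hx1, h2, hx2]
      · rw [hasseD_eq_zero_of_forall_degreeOf_eq_zero' hU h2, mul_zero]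
  · intro hnot
    exfalso
    exact hnot (Finset.HasAntidiagonal.mem_antidiagonal.mpr rfl)

/-- Degrees of a product in disjoint variables: `VU` is free of `X_{t₀}`-degree beyond that of
`U`, and for `h ≠ t₀` its degree in `X_h` is that of `V` (when `U ≠ 0`) — here only the easy
inequalities. [folklore] -/
theorem degreeOf_mul_le_of_disjoint {V U : MvPolynomial σ R} {t₀ : σ} (hV : V.degreeOf t₀ = 0)
    (hU : ∀ h, h ≠ t₀ → U.degreeOf h = 0) (h : σ) :
    (V * U).degreeOf h ≤ max (V.degreeOf h) (U.degreeOf h) := by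
  refine (degreeOf_mul_le h V U).trans ?_
  by_cases hh : h = t₀
  · rw [hh, hV, zero_add]; exact le_max_right _ _
  · rw [hU h hh, add_zero]; exact le_max_left _ _

end Disjoint

end Roth

end Literature.NumberTheory.DiophantineGeometry
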